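import Summits.BirchSwinnertonDyer.BirchSwinnertonDyer.Theorems.PrintCFramBottomClassIndexLawFiveLeBorelNonScalarLeaf
import Summits.BirchSwinnertonDyer.BirchSwinnertonDyer.Theorems.PrintCFramBottomClassIndexLawFiveLeBorelH1Vanishing
import HarnessLib

/-!
# Route `PrintCFram`, crux C2 `BottomClassIndexLawFiveLe` (stmt-BirchSwinnertonDyer-20372), line
# `eisenstein-resource-bdp-line` (S2 `stub_kolyvaginUpper_borelCM`): the Borel substitute for «`E[p]` simple» —
# **the `Γ_K`-STABLE SUBGROUPS OF `W[p]` ARE `0`, THE RATIONAL LINE `W[𝔭]`, AND `W[p]`**, for every quadratic `K`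
# (cell `bsd-print-cfram`, seat `bsd-line-cfram-p1-w4` g3; helper `--supports` 20372; 0 facts, 0 defs)

HONEST FRAMING. Nothing about BSD is proved here, and nothing of S2 itself. The tree's Kolyvagin machine
(`HeegnerPointsKolyvagin*`) takes from `HasSurjectiveModNGaloisRep` the input hS = `KolyvaginImage.eq_bot_or_eq_top`
(«a `Γ_K`-stable subgroup of `E[p]` is `0` or `E[p]`», Gross 1991 proof of Prop. 9.3), which is FALSE on the Borel
CM-ramified class (the rational line `Φ = W[𝔭]`). This file proves its honest replacement on the class: for every
quadratic number field `K` (Heegner fields AND `ℚ(√−p)` alike) the `res Γ_K`-stable subgroups of `W[p]` are exactly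
`0`, `Φ`, `W[p]` — in particular **the stable line is UNIQUE** (the level-`1` case of the layer structure
«`Γ`-submodules of `𝓞/𝔭^k` are the `𝔭^j`» of the crux's visibility analysis, `Lines/borel-heegner-squeeze-H1check.md` §3).
Whoever ports Gross Prop. 9.3 / McCallum (2) to the Borel prime (the research step (γ)) starts from this trichotomy
instead of hS; hCe is the sibling file `…BorelScalarCommutant.lean`.

MECHANISM (kit 0; no CM theory). In a frame of `W[p]` the twist endomorphism `μ = √−p`
(`BorelHomothety.exists_sqrt_end_of_cmRamified`) is `A ≠ 0` with `A² = 0`; the non-scalar `σ ∈ Γ_{ℚ(√−p)}` of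
`…BorelNonScalarLeaf` gives `ρ̄(σ) = u + vA` (`u, v ≠ 0`) and `σ² ∈ res Γ_K` (index `2`), so the NON-SCALAR
`u² + 2uvA` lies in `ρ̄(res Γ_K)`. A stable subgroup `Φ` of order `p` is cyclic, so `ρ̄(σ²)P = nP` on a generator,
i.e. `AP = λP`; `A² = 0` forces `λ = 0`: **every stable line lies in `ker A = ker μ|_{W[p]}`**, a proper subgroup,
hence equals it (`#ker = p`).

* `eq_of_stable_of_card_eq_of_cmRamified` — two `res Γ_K`-stable subgroups of `W[p]` of order `p` coincide;
* `eq_bot_or_eq_or_eq_top_of_stable_of_cmRamified` — trichotomy against any rational line `Φ` (`IsRationalLine`);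
* **`exists_line_trichotomy_of_cmRamified`** — machine currency: on `geomTorsion (W.baseChange K) p ⊂ E(K̄)` with
  `absoluteGaloisGroup K` there is a stable `Φ'` of order `p` such that every stable subgroup is `⊥`, `Φ'` or `⊤`
  (transport along `RatClosure.torsionEquiv`).

THEOREMS ONLY; no definition, no named fact, no `sorry`; imports no `Theses` module. BSD is not proved by any of
this; no summit statement is proved by this seat.
References: [GrossLMS1991] §9, proof of Prop. 9.3; [GreenbergVatsal2000] §2 p. 28 (the line `Φ`); [SilvermanAEC2009]
III.§7, X.5 Prop. 5.4.
-/

set_option autoImplicit false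
-- `…BirchSwinnertonDyer.BirchSwinnertonDyer.Theorems…` is the problem's mandated namespace (D-0017).
set_option linter.dupNamespace false

noncomputable section

open scoped Classical NumberField Matrix

namespace Summit.BirchSwinnertonDyer.BirchSwinnertonDyer.Theorems.PrintCFram.BorelNonScalar

open WeierstrassCurve Field Literature.NumberTheory.EllipticCurves Literature.NumberTheory.GaloisRepresentations
  Literature.NumberTheory.EllipticCurves.Rank1Residual Summit.BirchSwinnertonDyer.Rank1Residual.X12.O11
  Summit.BirchSwinnertonDyer.BirchSwinnertonDyer.Theorems.PrintCFram.BorelHomothety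

variable (W : WeierstrassCurve ℚ) [W.IsElliptic] (p : ℕ) [hp : Fact p.Prime]
  (K : Type) [Field K] [NumberField K]

/-- **Uniqueness of the stable line.** For `W/ℚ` elliptic with CM, `p ≥ 5` ramified in the CM field, and any
quadratic number field `K`: two subgroups of `W[p] ⊂ W(ℚ̄)` of order `p`, each stable under `res Γ_K`, are EQUAL
(both are the kernel of `μ = √−p` on `W[p]`: a stable line is an eigenline of the non-scalar unipotent
`ρ̄(σ²) = u² + 2uvA ∈ ρ̄(res Γ_K)`, hence of `A`, and `A² = 0`, `A ≠ 0`).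
[cite: GrossLMS1991, §9 proof of Prop. 9.3 (the simplicity input, replaced)] [cite: GreenbergVatsal2000, §2 (p. 28)] -/
theorem eq_of_stable_of_card_eq_of_cmRamified (hCM : W.HasCM) (h5 : 5 ≤ p) (hram : CMRamified W p)
    (hK2 : Module.finrank ℚ K = 2) {Φ₁ Φ₂ : AddSubgroup (W.geomTorsion (p : ℤ))}
    (h₁ : ∀ (g : absoluteGaloisGroup K), ∀ P ∈ Φ₁, absGaloisRestrict ℚ K g • P ∈ Φ₁) (hc₁ : Nat.card Φ₁ = p)
    (h₂ : ∀ (g : absoluteGaloisGroup K), ∀ P ∈ Φ₂, absGaloisRestrict ℚ K g • P ∈ Φ₂) (hc₂ : Nat.card Φ₂ = p) :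
    Φ₁ = Φ₂ := by
  have hpr : p.Prime := hp.out
  haveI : NeZero p := ⟨hpr.ne_zero⟩
  letI : Module (ZMod p) (W.geomTorsion (p : ℤ)) := AddSubgroup.torsionBy.zmodModule
  have h2 : (2 : ZMod p) ≠ 0 := by
    refine Ring.two_ne_zero ?_
    rw [ZMod.ringChar_zmod_n]
    omega
  have hp0 : (p : AlgebraicClosure ℚ) ≠ 0 := Nat.cast_ne_zero.mpr hpr.ne_zero
  haveI : Finite (W.geomTorsion (p : ℤ)) :=
    finite_torsionPoints_holds W (AlgebraicClosure ℚ) (n := p) (by exact_mod_cast hpr.ne_zero)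
  have hcardE : Nat.card (W.geomTorsion (p : ℤ)) = p ^ 2 :=
    card_torsionPoints_eq_sq_holds W (AlgebraicClosure ℚ) (n := p) hp0
  -- inputs: `μ`, the non-scalar `σ` fixing `√−p`, `σ² = res g₁`
  obtain ⟨s, μ, m, hs, hm, hμμ, hμ₁, -⟩ := exists_sqrt_end_of_cmRamified W p hCM h5 hram
  obtain ⟨σ, hσs, hσ⟩ := exists_frobenius_nonScalar_of_cmRamified p W hCM h5 hram hs
  obtain ⟨g₁, hg₁⟩ : σ ^ 2 ∈ (absGaloisRestrict ℚ K).range := by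
    have hHi : (absGaloisRestrict ℚ K).range.index = 2 :=
      (index_range_absGaloisRestrict_eq_finrank ℚ K).trans hK2
    haveI : (absGaloisRestrict ℚ K).range.Normal := Subgroup.normal_of_index_eq_two hHi
    haveI : (absGaloisRestrict ℚ K).range.FiniteIndex := ⟨by rw [hHi]; decide⟩
    have := Subgroup.pow_index_mem (absGaloisRestrict ℚ K).range σ
    rwa [hHi] at this
  change absGaloisRestrict ℚ K g₁ = σ ^ 2 at hg₁
  have hpm : (p : ℤ) ∣ m := Int.natCast_dvd.mpr (by rw [hm])
  obtain ⟨P₀, hP₀, hμP₀⟩ := exists_mem_geomTorsion_apply_ne_zero W p hμμ hm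
  -- a frame of `W[p]`
  obtain ⟨e, Φ, he, -, -, -, -⟩ := exists_frame_galoisRepTorsion_rat W p
  have hμmem : ∀ P : W.geomTorsion (p : ℤ), μ (P : W.geomPoints) ∈ W.geomTorsion (p : ℤ) := by
    intro P
    rw [AddSubgroup.torsionBy.nsmul_iff, ← map_nsmul, AddSubgroup.torsionBy.nsmul_iff.mp P.2, map_zero]
  set μV : W.geomTorsion (p : ℤ) →+ W.geomTorsion (p : ℤ) :=
    { toFun := fun P => ⟨μ P, hμmem P⟩
      map_zero' := Subtype.ext (by simp)
      map_add' := fun P Q => Subtype.ext (by simp) } with hμV_def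
  set A : Matrix (Fin 2) (Fin 2) (ZMod p) := LinearMap.toMatrix'
    ((e.toAddMonoidHom.comp (μV.comp e.symm.toAddMonoidHom)).toZModLinearMap p) with hA_def
  have hA : ∀ x : W.geomTorsion (p : ℤ), A *ᵥ e x = e (μV x) := by
    intro x
    rw [hA_def, LinearMap.toMatrix'_mulVec]
    change e (μV (e.symm (e x))) = e (μV x)
    rw [e.symm_apply_apply]
  set B : absoluteGaloisGroup ℚ → Matrix (Fin 2) (Fin 2) (ZMod p) :=
    fun τ => ((Φ (galoisRepTorsion W p τ) : GL (Fin 2) (ZMod p)) : Matrix (Fin 2) (Fin 2) (ZMod p))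
    with hB_def
  have hB : ∀ (τ : absoluteGaloisGroup ℚ) (x : W.geomTorsion (p : ℤ)), e (τ • x) = B τ *ᵥ e x := by
    intro τ x
    rw [hB_def]
    exact he (galoisRepTorsion W p τ) x
  have hext : ∀ {M N : Matrix (Fin 2) (Fin 2) (ZMod p)},
      (∀ x : W.geomTorsion (p : ℤ), M *ᵥ e x = N *ᵥ e x) → M = N := by
    intro M N hMN
    refine Matrix.ext_of_mulVec_single fun i => ?_
    obtain ⟨x, hx⟩ := e.surjective (Pi.single i 1)
    rw [← hx, hMN x]
  have hBmul : ∀ τ τ' : absoluteGaloisGroup ℚ, B (τ * τ') = B τ * B τ' := by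
    intro τ τ'
    rw [hB_def]
    change ((Φ (galoisRepTorsion W p (τ * τ')) : GL (Fin 2) (ZMod p)) : Matrix (Fin 2) (Fin 2) (ZMod p)) = _
    rw [map_mul, map_mul, Units.val_mul]
  have hA0 : A ≠ 0 := by
    intro hA0
    apply hμP₀
    have h0 : e (μV ⟨P₀, hP₀⟩) = 0 := by rw [← hA, hA0, Matrix.zero_mulVec]
    rw [map_eq_zero_iff e e.injective] at h0
    exact congrArg Subtype.val h0
  have hAA : A * A = 0 := hext fun x => by
    rw [← Matrix.mulVec_mulVec, hA, hA, Matrix.zero_mulVec, ← map_zero e]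
    congr 1
    refine Subtype.ext ?_
    change μ (μ (x : W.geomPoints)) = 0
    obtain ⟨k, hk⟩ := hpm
    rw [hμμ, hk, mul_comm, ← smul_smul, natCast_zsmul, AddSubgroup.torsionBy.nsmul_iff.mp x.2, smul_zero]
  have hσA : B σ * A = A * B σ := hext fun x => by
    calc (B σ * A) *ᵥ e x = B σ *ᵥ (A *ᵥ e x) := (Matrix.mulVec_mulVec _ _ _).symm
      _ = e (σ • μV x) := by rw [hA, ← hB]
      _ = e (μV (σ • x)) := by
        congr 1
        exact Subtype.ext (hμ₁ σ hσs x).symm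
      _ = (A * B σ) *ᵥ e x := by rw [← Matrix.mulVec_mulVec, ← hB, hA]
  -- `B σ = u + vA` with `u, v ≠ 0`; `B (res g₁) = u² + 2uvA`
  have hSns : ∀ u : ZMod p, B σ ≠ u • (1 : Matrix (Fin 2) (Fin 2) (ZMod p)) := by
    intro u hu
    obtain ⟨Q, hQ⟩ := hσ (u.val : ℤ)
    apply hQ
    apply e.injective
    rw [hB, hu, Matrix.smul_mulVec, Matrix.one_mulVec, map_zsmul,
      ← Int.cast_smul_eq_zsmul (ZMod p), Int.cast_natCast, ZMod.natCast_zmod_val]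
  obtain ⟨u, v, huv⟩ :=
    exists_eq_smul_one_add_smul_of_commute_of_ne (ne_smul_one_of_mul_self_eq_zero hA0 hAA) hσA
  have hv0 : v ≠ 0 := by
    intro hv
    exact hSns u (by rw [huv, hv, zero_smul, add_zero])
  have hu0 : u ≠ 0 := by
    intro hu
    rw [hu, zero_smul, zero_add] at huv
    have hval : B σ * B σ = 0 := by
      rw [huv, Matrix.smul_mul, Matrix.mul_smul, hAA, smul_zero, smul_zero]
    refine Units.ne_zero (Φ (galoisRepTorsion W p σ) * Φ (galoisRepTorsion W p σ)) ?_
    rw [Units.val_mul]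
    exact hval
  have h2uv : 2 * u * v ≠ 0 := mul_ne_zero (mul_ne_zero h2 hu0) hv0
  have hH : B (absGaloisRestrict ℚ K g₁) =
      (u * u) • (1 : Matrix (Fin 2) (Fin 2) (ZMod p)) + (2 * u * v) • A := by
    rw [hg₁, pow_two, hBmul, huv]
    simp only [add_mul, mul_add, Matrix.smul_mul, Matrix.mul_smul, Matrix.one_mul, Matrix.mul_one, hAA,
      smul_zero, add_zero, smul_smul]
    module
  -- KEY: a `res g₁`-stable subgroup of order `p` is killed by `μ`
  have key : ∀ (Ψ : AddSubgroup (W.geomTorsion (p : ℤ))),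
      (∀ P ∈ Ψ, absGaloisRestrict ℚ K g₁ • P ∈ Ψ) → Nat.card Ψ = p → ∀ P ∈ Ψ, μV P = 0 := by
    intro Ψ hΨ hcΨ P hP
    by_cases hP0 : P = 0
    · rw [hP0, map_zero]
    -- `Ψ = ℤ·P`, so `res g₁ • P = n • P`
    have hzm : AddSubgroup.zmultiples P = Ψ := by
      have hle : AddSubgroup.zmultiples P ≤ Ψ := (AddSubgroup.zmultiples_le).mpr hP
      refine AddSubgroup.eq_of_le_of_card_ge hle ?_
      have hdvd : Nat.card (AddSubgroup.zmultiples P) ∣ Nat.card Ψ := AddSubgroup.card_dvd_of_le hle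
      rw [hcΨ] at hdvd ⊢
      rcases (Nat.dvd_prime hpr).mp hdvd with h1 | hp'
      · exfalso
        apply hP0
        have := (AddSubgroup.card_eq_one.mp h1)
        have hmem : P ∈ AddSubgroup.zmultiples P := AddSubgroup.mem_zmultiples P
        rw [this] at hmem
        exact (AddSubgroup.mem_bot.mp hmem)
      · rw [hp']
    obtain ⟨n, hn⟩ : ∃ n : ℤ, n • P = absGaloisRestrict ℚ K g₁ • P := by
      have hmem : absGaloisRestrict ℚ K g₁ • P ∈ AddSubgroup.zmultiples P := by
        rw [hzm]; exact hΨ P hP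
      exact AddSubgroup.mem_zmultiples_iff.mp hmem
    -- in the frame: `A eP = λ eP`
    have hvec : (2 * u * v) • (A *ᵥ e P) = ((n : ZMod p) - u * u) • e P := by
      have h1 : B (absGaloisRestrict ℚ K g₁) *ᵥ e P = (n : ZMod p) • e P := by
        rw [← hB, ← hn, map_zsmul, Int.cast_smul_eq_zsmul]
      rw [hH, Matrix.add_mulVec, Matrix.smul_mulVec, Matrix.smul_mulVec, Matrix.one_mulVec] at h1
      rw [sub_smul]
      exact eq_sub_of_add_eq' h1
    set lam : ZMod p := (2 * u * v)⁻¹ * ((n : ZMod p) - u * u) with hlam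
    have hAP : A *ᵥ e P = lam • e P := by
      have := congrArg (fun w => (2 * u * v)⁻¹ • w) hvec
      simp only [smul_smul, inv_mul_cancel₀ h2uv, one_smul] at this
      rw [this, hlam]
    -- `A² = 0` forces `λ = 0`
    have heP : e P ≠ 0 := fun h0 => hP0 (e.injective (by rw [h0, map_zero]))
    have hlam0 : lam = 0 := by
      have h0 : (lam * lam) • e P = 0 := by
        rw [mul_smul, ← hAP, ← Matrix.mulVec_smul, ← hAP, Matrix.mulVec_mulVec, hAA, Matrix.zero_mulVec]
      rcases smul_eq_zero.mp h0 with h | h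
      · exact mul_self_eq_zero.mp h
      · exact absurd h heP
    apply e.injective
    rw [← hA, hAP, hlam0, zero_smul, map_zero]
  -- both lines lie in `ker μ|_{W[p]}`, a proper subgroup, hence of order `p`
  set K₀ : AddSubgroup (W.geomTorsion (p : ℤ)) := μV.ker with hK₀
  have hle₁ : Φ₁ ≤ K₀ := fun P hP => (AddMonoidHom.mem_ker).mpr (key Φ₁ (h₁ g₁) hc₁ P hP)
  have hle₂ : Φ₂ ≤ K₀ := fun P hP => (AddMonoidHom.mem_ker).mpr (key Φ₂ (h₂ g₁) hc₂ P hP)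
  have hK₀top : K₀ ≠ ⊤ := by
    intro htop
    have hmem : (⟨P₀, hP₀⟩ : W.geomTorsion (p : ℤ)) ∈ K₀ := by rw [htop]; exact AddSubgroup.mem_top _
    rw [hK₀, AddMonoidHom.mem_ker] at hmem
    exact hμP₀ (congrArg Subtype.val hmem)
  have hcK₀ : Nat.card K₀ = p := by
    have hdvd : Nat.card K₀ ∣ Nat.card (W.geomTorsion (p : ℤ)) := AddSubgroup.card_addSubgroup_dvd_card K₀
    rw [hcardE] at hdvd
    obtain ⟨i, hi, hK⟩ := (Nat.dvd_prime_pow hpr).mp hdvd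
    have hp_le : Nat.card Φ₁ ∣ Nat.card K₀ := AddSubgroup.card_dvd_of_le hle₁
    rw [hc₁, hK] at hp_le
    have hi0 : i ≠ 0 := by
      rintro rfl
      rw [pow_zero] at hp_le
      have := Nat.le_of_dvd one_pos hp_le
      have := hpr.two_le
      omega
    have hi2 : i ≠ 2 := by
      rintro rfl
      exact hK₀top (AddSubgroup.eq_top_of_card_eq K₀ (by rw [hK, hcardE]))
    have hi1 : i = 1 := by omega
    rw [hK, hi1, pow_one]
  have hE₁ : Φ₁ = K₀ := AddSubgroup.eq_of_le_of_card_ge hle₁ (by rw [hcK₀, hc₁])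
  have hE₂ : Φ₂ = K₀ := AddSubgroup.eq_of_le_of_card_ge hle₂ (by rw [hcK₀, hc₂])
  rw [hE₁, hE₂]

/-- **Trichotomy (the Borel substitute for hS).** For `W/ℚ` elliptic with CM, `p ≥ 5` ramified in the CM field, a
quadratic number field `K`, and a rational line `Φ ≤ W[p]` (`IsRationalLine`: `Γ_ℚ`-stable of order `p`; it exists,
`RationalLine.exists_rationalLine_of_cmRamified`): every `res Γ_K`-stable subgroup of `W[p]` is `⊥`, `Φ` or `⊤`.
[cite: GrossLMS1991, §9 proof of Prop. 9.3 (the simplicity input, replaced)] [cite: GreenbergVatsal2000, §2 (p. 28)] -/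
theorem eq_bot_or_eq_or_eq_top_of_stable_of_cmRamified (hCM : W.HasCM) (h5 : 5 ≤ p) (hram : CMRamified W p)
    (hK2 : Module.finrank ℚ K = 2) {Φ : AddSubgroup (W.geomTorsion (p : ℤ))} (hΦ : IsRationalLine W p Φ)
    (H : AddSubgroup (W.geomTorsion (p : ℤ)))
    (hH : ∀ (g : absoluteGaloisGroup K), ∀ P ∈ H, absGaloisRestrict ℚ K g • P ∈ H) :
    H = ⊥ ∨ H = Φ ∨ H = ⊤ := by
  have hpr : p.Prime := hp.out
  have hp0 : (p : AlgebraicClosure ℚ) ≠ 0 := Nat.cast_ne_zero.mpr hpr.ne_zero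
  haveI : Finite (W.geomTorsion (p : ℤ)) :=
    finite_torsionPoints_holds W (AlgebraicClosure ℚ) (n := p) (by exact_mod_cast hpr.ne_zero)
  have hcardE : Nat.card (W.geomTorsion (p : ℤ)) = p ^ 2 :=
    card_torsionPoints_eq_sq_holds W (AlgebraicClosure ℚ) (n := p) hp0
  have hdvd : Nat.card H ∣ Nat.card (W.geomTorsion (p : ℤ)) := AddSubgroup.card_addSubgroup_dvd_card H
  rw [hcardE] at hdvd
  obtain ⟨i, hi, hK⟩ := (Nat.dvd_prime_pow hpr).mp hdvd
  rcases Nat.lt_or_ge i 1 with hi1 | hi1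
  · left
    have hi0 : i = 0 := by omega
    rw [hi0, pow_zero] at hK
    exact AddSubgroup.eq_bot_of_card_eq H hK
  rcases Nat.lt_or_ge i 2 with hi2 | hi2
  · right; left
    have hi1' : i = 1 := by omega
    rw [hi1', pow_one] at hK
    exact eq_of_stable_of_card_eq_of_cmRamified W p K hCM h5 hram hK2 hH hK
      (fun g P hP => hΦ.2 (absGaloisRestrict ℚ K g) P hP) hΦ.1
  · right; right
    have hi2' : i = 2 := by omega
    rw [hi2'] at hK
    exact AddSubgroup.eq_top_of_card_eq H (by rw [hK, hcardE])

/-- **The trichotomy in the machine's currency.** For `W/ℚ` elliptic with CM, `p ≥ 5` ramified in the CM field and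
a quadratic number field `K`: on `E[p] = geomTorsion (W.baseChange K) p ⊂ E(K̄)` with its `Γ_K = absoluteGaloisGroup K`
action there is a stable subgroup `Φ'` of order `p` such that EVERY stable subgroup is `⊥`, `Φ'` or `⊤` — the Borel
replacement of `KolyvaginImage.eq_bot_or_eq_top` (hS), transported along `RatClosure.torsionEquiv`.
[cite: GrossLMS1991, §9 proof of Prop. 9.3 (the simplicity input, replaced)] -/
theorem exists_line_trichotomy_of_cmRamified (hCM : W.HasCM) (h5 : 5 ≤ p) (hram : CMRamified W p)
    (hK2 : Module.finrank ℚ K = 2) :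
    ∃ Φ' : AddSubgroup (geomTorsion (W.baseChange K) (p : ℤ)), Nat.card Φ' = p ∧
      (∀ (g : absoluteGaloisGroup K) (t : geomTorsion (W.baseChange K) (p : ℤ)), t ∈ Φ' → g • t ∈ Φ') ∧
      ∀ H : AddSubgroup (geomTorsion (W.baseChange K) (p : ℤ)),
        (∀ (g : absoluteGaloisGroup K) (t : geomTorsion (W.baseChange K) (p : ℤ)), t ∈ H → g • t ∈ H) →
        H = ⊥ ∨ H = Φ' ∨ H = ⊤ := by
  obtain ⟨Φ, hstab, hcard⟩ := RationalLine.exists_rationalLine_of_cmRamified W p hCM h5 hram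
  have hΦ : IsRationalLine W p Φ := ⟨hcard, hstab⟩
  set θ := RatClosure.torsionEquiv (K := K) W (p : ℤ) with hθ
  refine ⟨Φ.map θ.toAddMonoidHom, ?_, ?_, ?_⟩
  · exact (Nat.card_congr (θ.addSubgroupMap Φ).toEquiv).symm.trans hcard
  · intro g t ht
    rw [AddSubgroup.mem_map] at ht ⊢
    obtain ⟨P, hP, rfl⟩ := ht
    refine ⟨absGaloisRestrict ℚ K g • P, hstab _ P hP, ?_⟩
    exact RatClosure.torsionEquiv_smul W (p : ℤ) g P
  · intro H hH
    set H₀ : AddSubgroup (W.geomTorsion (p : ℤ)) := H.comap θ.toAddMonoidHom with hH₀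
    have hH₀stab : ∀ (g : absoluteGaloisGroup K), ∀ P ∈ H₀, absGaloisRestrict ℚ K g • P ∈ H₀ := by
      intro g P hP
      rw [hH₀, AddSubgroup.mem_comap] at hP ⊢
      change θ (absGaloisRestrict ℚ K g • P) ∈ H
      rw [RatClosure.torsionEquiv_smul]
      exact hH g _ hP
    have hHmap : H = H₀.map θ.toAddMonoidHom :=
      (AddSubgroup.map_comap_eq_self_of_surjective θ.surjective H).symm
    rcases eq_bot_or_eq_or_eq_top_of_stable_of_cmRamified W p K hCM h5 hram hK2 hΦ H₀ hH₀stab with h | h | h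
    · left
      rw [hHmap, h, AddSubgroup.map_bot]
    · right; left
      rw [hHmap, h]
    · right; right
      rw [hHmap, h, AddSubgroup.map_top_of_surjective _ θ.surjective]

end Summit.BirchSwinnertonDyer.BirchSwinnertonDyer.Theorems.PrintCFram.BorelNonScalar
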